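import Mathlib
import Summits.ABC.IUTFork.Joshi.ThetaValuesLocus
import HarnessLib

/-!
# [J-III] §5.1–§5.2 «Some local preliminaries»: the period rings `B ⊂ B_dR`, `B⁺_dR`, `B⁺_cris ⊂ B_cris`, `t`, `B_E`,
# `B̃_E = B ⊗_{ℚ_p} E`, `B_e` — Joshi's local ring signature, typed OVER slot E-t3's landed `PeriodRingDatum`

Block E (rung LADDER-ABC:A2.E) typing file of the abc-iut cell, seat abc-iut-E-t9, slot T-09 = K. Joshi, *Construction of
Arithmetic Teichmüller Spaces III*, arXiv:2401.13508v4 («Preliminary version for comments», unrefereed; bib `Joshi2024ATS3`),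
**§5.1–§5.2**, PDF pp. 38–40 of the cell's render `HOME/lit/renders/Joshi-arxiv-2401.13508/pNNNN.txt` («p.N l.M» = line M
of PDF page N). TAKES NO SIDE on [IUTchIII] Cor. 3.12, on Joshi's claims or on Mochizuki's report on them; typed ≠ proved ≠
endorsed. SIGNATURE file: the structures below bundle the CARRIERS Joshi names in §5 and the facts of [Fargues–Fontaine 2018]
(= his «[FF18]») / [Fontaine 1994a] he invokes, each as a FIELD with its locator — hypotheses on abstract data, never
instantiated here, nothing of Joshi's asserted; his one labelled statement (Lemma 5.2.3.1, «Proof. This is [FF18, Prop.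
1.6.9]») and the identifications (5.2.5.3)–(5.2.5.4), (5.2.6.1) are `def … : Prop` CLAIMS; what follows from the signature is
PROVED (`BeSubalgebra`, `productMap_range_eq_BE`, `BdRplus_ne_top`, …). The §5.3 enlargement operators are in
`Joshi/Enlargements.lean` (p429219).

DESIGN (plan/FOUNDATIONS.md v3.0 §G2–G5, abc-iut-found 06:10Z; plan/E/ASSIGNMENTS.md §3 «T-09 EXTENDS E-t3's PeriodRingDatum»):
* The Fargues–Fontaine ring `B = B_{ℂ_p^♭,ℚ_p}` with `|−|_ρ`, `φ`, Galois, `B⁺ = {|−|_1 ≤ 1}` IS slot E-t3's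
  `Summit.ABC.IUTFork.Joshi.PeriodRingDatum F B E0 Y K G` (ThetaValuesLocus.lean, landed) — reused as the PARAMETER `D`, not
  restated (§G5: the only period ring absent from Mathlib + tree, INTERFACE justified).
* `B_dR` is an ambient field `Ω` with `Algebra ℚ_[p] Ω`; `B⁺_dR`, `B⁺_cris`, `B_cris`, `B[1/t]`, `B_e`, `E`, `B_E` are
  `ℚ_p`-subalgebras of `Ω`, and (5.2.4.2) `B ↪ B_dR` is the field `toBdR` — so the injections (5.2.4.1)–(5.2.4.2), (5.2.6.2) hold BY
  DESIGN. `Ω` is instantiable at the tree's REAL `Literature.NumberTheory.PAdicHodge.FracBdR` (B⁺_dR a DVR: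
  `instIsDiscreteValuationRingBdRPlus`, `t`: `tBdR`, `B_dR^{Γ}=F`: `fixedPoints_fracBdR_eq_range`; §G4 = IMPORT) — that
  instantiation is a merge row (batch 3), not done here, which keeps this file light.
* No instance is declared: carriers are parameters with type-class arguments; the `G`-action on `Ω` is the hom `galΩ` and
  `mulActionΩ` is a `def` to be bound with `letI` by consumers of `Joshi/Enlargements.lean`.
MERGE-DEBT recorded for E-plan-2 §3: E-t10 `ThetaLiftDatum` / E-t11 `AdelicLiftDatum` carry «the §5 rings of slot T-09» as bare
fields; the reconciliation map is `toBdR` + `BE` + `Btilde` below.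

Source sentences (verbatim, own reading) ↦ declarations:
* §5 p.38 l.22–24 «Let `p` be a prime … `ℂ_p` … with its canonical action of the absolute Galois group `G_{ℚ_p}`» ↦ parameters
  `p`, `G` (E-t3's index type, here with `[Group G]`), `galΩ`.
* **§5.1** p.38 l.25–32 «Let `B⁺_dR` be the ring of p-adic periods constructed in [Fontaine, 1994a] for the (Galois group,
  field) pair `(G_{ℚ_p}, ℚ_p)` and let `B_dR` be its quotient field. … The construction of `B_dR` is functorial» ↦ `Ω`,
  `BdRplus`, `exists_t_pow_mul_mem` (quotient field), `galΩ`/`galΩ_toBdR` (functoriality).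
* **§5.2** p.38 l.33–51 «Let `B_p = B_{ℂ_p^♭,ℚ_p}` be the ring constructed in [FF18, Chapitre 2] … there exists an element
  `t ∈ B` which generates the maximal ideal of the canonical point of `X_{ℂ_p^♭,ℚ_p}` … the ring `B[1/t]` is also quite
  natural. Let `B⁺_p = B⁺_{ℂ_p^♭,ℚ_p}` be the ring constructed in [FF18, 1.10]» ↦ `D` (E-t3), `t`, `Bt`.
* **§5.2.1** p.39 l.1–12 «`B ⊃ B⁺ ⊃ W(𝒪_{ℂ_p^♭})[1/p]` and `W(𝒪_{ℂ_p^♭})[1/p] ⊃ W(F̄_p)[1/p] = ℚ_p^{unram}` … Hence `B` and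
  `B⁺` are `E_0`-algebras for any finite unramified extension `E_0/ℚ_p`. This remark will be used in what follows.» ↦
  `BEDatum.E0_subset_Bplus`.
* **§5.2.2** p.39 l.13–24 «`B⁺_dR` is the completion of the local ring of `X_{ℂ_p^♭,ℚ_p}` at the canonical point … hence
  the ring `B⁺_dR` is a discrete valuation ring. Moreover the maximal ideal of this local ring is generated by the element
  `t` and `B_dR = B⁺_dR[1/t]`.» ↦ `isDVR_BdRplus`, `t_mem_BdRplus`, `isMaximal_span_t`, `exists_t_pow_mul_mem`; PROVED:
  `not_isUnit_t`, `BdRplus_ne_top`.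
* Rmk. 5.2.2.1 p.39 l.25–28 «`B` has uncountably many maximal ideals … my construction of `Θ̃_Joshi` and `Θ̃_Mochizuki`
  require using the fact that `B` has infinitely many maximal ideals.» ↦ READING predicate `BHasInfinitelyManyMaximalIdeals`.
* **§5.2.3** p.39 l.29–40 «Let `E` be a p-adic field and let `E_0 ⊂ E` be its maximal unramified subfield … `B_E = B_{ℂ_p^♭,E}`.
  Lemma 5.2.3.1. … natural isomorphism `B_E ≃ B_{ℂ_p^♭,ℚ_p} ⊗_{E_0} E` (5.2.3.2). Proof. This is [FF18, Proposition 1.6.9].»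
  and **§5.2.4** p.39 l.41–49 «(5.2.4.1) `B_E = B ⊗_{E_0} ↪ B_dR` … (5.2.4.2) `B = B_p ↪ B_dR`» ↦ `BEDatum`, `BE := B ⊔ E`
  inside `Ω` (so `B_E` is DEFINED through (5.2.4.1)), CLAIM `BELinDisjoint` (Lemma 5.2.3.1 ∧ (5.2.4.1) in instance-free form).
* **§5.2.5** p.39 l.50–p.40 l.16 «(5.2.5.1) `B̃ = B ⊗_{ℚ_p} E` … (5.2.5.3) `B ⊗_{ℚ_p} E_0 = B ⊕ ··· ⊕ B` ([E_0:ℚ_p] factors) …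
  (5.2.5.4) `B̃_E = B_E ⊕ ··· ⊕ B_E` … a finite and free `B`-module … (5.2.5.5) the natural diagonal embedding
  `B_E ↪ B̃_E`» ↦ `Btilde := B ⊗[ℚ_[p]] E` (Mathlib), `btildeToBdR` with PROVED `productMap_range_eq_BE`; CLAIMS
  `BtildeE0Splits` (5.2.5.3), `BtildeSplits` (5.2.5.4) ((5.2.5.5) is definable from any witness of (5.2.5.4): no extra claim).
* **§5.2.6** p.40 l.17–34 «(5.2.6.1) `B_e = B⁺[1/t]^{φ=1} = B[1/t]^{φ=1} = B_cris^{φ=1}` … `X − {x_can} = Spec(B_e)` …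
  (5.2.6.2) `B⁺ ↪ B⁺_cris ↪ B⁺_cris[1/t] = B_cris ↪ B_dR`. … Direct construction of the theta-value locus in `B_cris` or
  `B_dR` does not seem to be possible.» ↦ `Bcrisplus`, `Bcris`, `image_Bplus_subset_Bcrisplus`, `Bcris_eq_adjoin`, `frobB`,
  `frob_t`, `frobCris`; `Be := B[1/t]^{φ=1}` spelled with `φ` on `B` only and PROVED to be a `ℚ_p`-subalgebra
  (`BeSubalgebra`); CLAIMS `BeEqBplusLoc`, `BeEqBcrisPhiOne` (the other two descriptions of (5.2.6.1), [FF18, Thm. 6.5.2]).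
* Rmk. 5.2.6.3 p.40 l.35–37 «the rings `B_dR ⊃ B_cris` depend on the choice of a fixed algebraic closure … the rings
  `B, B_e, B_E` of [FF18] do not» — READING, no declaration.
Nearest tree objects (analogues / future instantiation, nothing imported): `Literature.NumberTheory.PAdicHodge.BdRPlus`,
`FracBdR`, `tBdR`, `BmaxPlus`/`frobBmaxPlus` (crystalline side at `E = ℚ_p` in the `B_max` convention), `BdRPlusEmbedding`
(`K̄ ↪ B⁺_dR`). bears_on: LADDER-ABC:A2.E.
-/

noncomputable section

open scoped TensorProduct

namespace Summit.ABC.IUTFork.Joshi.ATS3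

variable {F B E0 : Type} [Field F] [CommRing B] [Field E0] {Y : Type} {K : Y → Type} [∀ y, Field (K y)]
  {G : Type} [Group G]

/-! ### §5.1–§5.2 the tower of period rings over `D : PeriodRingDatum` -/

/-- **SIGNATURE `PeriodRingTower D p Ω`** — [J-III] §5.1–§5.2 (p.38 l.25 – p.40 l.37): over E-t3's `D : PeriodRingDatum`
(the ring `B` with `|−|_ρ`, `φ = D.frob`, Galois `D.gal`, `B⁺ = D.Bplus`), the ambient field `Ω` playing `B_dR` (§5.1), the
embedding `B ↪ B_dR` (5.2.4.2), the element `t ∈ B` (§5.2), `B⁺_dR` a DVR with maximal ideal `(t)` and `B_dR = B⁺_dR[1/t]`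
(§5.2.2), `B⁺ ⊂ B⁺_cris ⊂ B_cris = B⁺_cris[1/t] ⊂ B_dR` (5.2.6.2), the Frobenius as a `ℚ_p`-algebra automorphism of `B`
extending `D.frob` with `φ(t) = p·t` and a Frobenius of `B_cris`, and the `G`-action on `B_dR` by `ℚ_p`-algebra automorphisms
extending `D.gal` (functoriality, §5.1 p.38 l.31–32). HYPOTHESIS structure: every field is a carrier or a cited [FF18] /
[Fontaine 1994a] fact with its locator; nothing is asserted. [claim: Joshi2024ATS3, status: disputed] -/
structure PeriodRingTower (D : PeriodRingDatum F B E0 Y K G) (p : ℕ) [Fact p.Prime] [Algebra ℚ_[p] B]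
    (Ω : Type) [Field Ω] [Algebra ℚ_[p] Ω] where
  /-- E-t3's residue characteristic is this file's `p` -/
  p_eq : D.p = p
  /-- (5.2.4.2) p.39 l.48–49 «`B = B_p ↪ B_dR`» [FF18, Prop. 10.2.7]: the embedding, as a `ℚ_p`-algebra map into `Ω = B_dR` -/
  toBdR : B →ₐ[ℚ_[p]] Ω
  /-- … which is injective -/
  toBdR_injective : Function.Injective toBdR
  /-- §5.2 p.38 l.38–40 «there exists an element `t ∈ B` which generates the maximal ideal of the canonical point of
  `X_{ℂ_p^♭,ℚ_p}`» [FF18, Thm. 6.5.2 and 10.1.1] -/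
  t : B
  /-- `t ≠ 0` -/
  t_ne_zero : t ≠ 0
  /-- §5.1 p.38 l.26–29 «`B⁺_dR` … the ring of p-adic periods constructed in [Fontaine, 1994a] … `B_dR` its quotient field»:
  `B⁺_dR ⊂ B_dR = Ω` -/
  BdRplus : Subalgebra ℚ_[p] Ω
  /-- §5.2.2 p.39 l.21–22 «the maximal ideal of this local ring is generated by the element `t`»: first, `t ∈ B⁺_dR` -/
  t_mem_BdRplus : toBdR t ∈ BdRplus
  /-- §5.2.2 p.39 l.20–21 «the ring `B⁺_dR` is a discrete valuation ring» [FF18, Thm. 6.5.2] -/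
  isDVR_BdRplus : IsDiscreteValuationRing BdRplus
  /-- §5.2.2 p.39 l.21–22: the ideal `(t) ⊂ B⁺_dR` is the maximal ideal -/
  isMaximal_span_t : (Ideal.span {(⟨toBdR t, t_mem_BdRplus⟩ : BdRplus)}).IsMaximal
  /-- §5.2.2 p.39 l.22–24 «`B_dR = B⁺_dR[1/t]`» (and §5.1 «quotient field»): every period is `t^{-n}·(element of B⁺_dR)` -/
  exists_t_pow_mul_mem : ∀ x : Ω, ∃ n : ℕ, toBdR t ^ n * x ∈ BdRplus
  /-- (5.2.6.2) p.40 l.28–32: `B⁺_cris ⊂ B_dR` -/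
  Bcrisplus : Subalgebra ℚ_[p] Ω
  /-- (5.2.6.2): `B_cris ⊂ B_dR` -/
  Bcris : Subalgebra ℚ_[p] Ω
  /-- (5.2.6.2): `B⁺ ↪ B⁺_cris` -/
  image_Bplus_subset_Bcrisplus : toBdR '' D.Bplus ⊆ Bcrisplus
  /-- (5.2.6.2): `B⁺_cris[1/t] = B_cris` -/
  Bcris_eq_adjoin : Bcris = Algebra.adjoin ℚ_[p] ((Bcrisplus : Set Ω) ∪ {(toBdR t)⁻¹})
  /-- the Frobenius `φ` of `B` ([FF18]; §5.2.6, §5.3.2) IS a `ℚ_p`-algebra automorphism, extending E-t3's bare `D.frob` -/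
  frobB : B ≃ₐ[ℚ_[p]] B
  /-- `frobB` is `D.frob` -/
  frobB_apply : ∀ x : B, frobB x = D.frob x
  /-- `φ(t) = p·t` (`t ∈ B^{φ=p}`, [FF18, 10.1.1]; used in §9.3 «`(1/t)B^{φ=p}`») -/
  frob_t : D.frob t = (p : B) * t
  /-- the Frobenius of `B_cris` (used in (5.2.6.1) «`B_cris^{φ=1}`»), a `ℚ_p`-algebra endomorphism of `B_cris` — NOT of
  `B_dR`, on which there is no Frobenius -/
  frobCris : Bcris →ₐ[ℚ_[p]] Bcris
  /-- `φ` on `B_cris` extends `φ` on `B⁺` along (5.2.6.2) -/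
  frobCris_toBdR : ∀ (x : B), x ∈ D.Bplus → ∀ h : toBdR x ∈ Bcris, (frobCris ⟨toBdR x, h⟩ : Ω) = toBdR (D.frob x)
  /-- §5 p.38 l.23–24 / §5.1 p.38 l.31–32 («canonical action of `G_{ℚ_p}` … The construction of `B_dR` is functorial»): `G`
  acts on `B_dR` by `ℚ_p`-algebra automorphisms … -/
  galΩ : G →* (Ω ≃ₐ[ℚ_[p]] Ω)
  /-- … compatibly with E-t3's action `D.gal` on `B` along `toBdR` -/
  galΩ_toBdR : ∀ (g : G) (x : B), galΩ g (toBdR x) = toBdR (D.gal g x)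

namespace PeriodRingTower

variable {D : PeriodRingDatum F B E0 Y K G} {p : ℕ} [Fact p.Prime] [Algebra ℚ_[p] B] {Ω : Type} [Field Ω]
  [Algebra ℚ_[p] Ω] (T : PeriodRingTower D p Ω)

/-! #### Derived facts (§5.2.2, (5.2.6.2)) -/

/-- `t ≠ 0` in `B_dR`. [folklore] -/
theorem toBdR_t_ne_zero : T.toBdR T.t ≠ 0 := fun h =>
  T.t_ne_zero (T.toBdR_injective (by rw [h, map_zero]))

/-- `t` is not a unit of `B⁺_dR` (it generates the maximal ideal, §5.2.2). DERIVED. [folklore] -/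
theorem not_isUnit_t : ¬ IsUnit (⟨T.toBdR T.t, T.t_mem_BdRplus⟩ : T.BdRplus) := fun h =>
  T.isMaximal_span_t.ne_top (Ideal.span_singleton_eq_top.2 h)

/-- `t⁻¹ ∉ B⁺_dR`. DERIVED. [folklore] -/
theorem t_inv_notMem_BdRplus : (T.toBdR T.t)⁻¹ ∉ T.BdRplus := fun h =>
  T.not_isUnit_t ⟨⟨⟨T.toBdR T.t, T.t_mem_BdRplus⟩, ⟨(T.toBdR T.t)⁻¹, h⟩,
    Subtype.ext (mul_inv_cancel₀ T.toBdR_t_ne_zero), Subtype.ext (inv_mul_cancel₀ T.toBdR_t_ne_zero)⟩, rfl⟩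

/-- Hence `B⁺_dR ⊊ B_dR` (§5.2.2 «`B_dR = B⁺_dR[1/t]`» is a genuine localisation). DERIVED. [folklore] -/
theorem BdRplus_ne_top : T.BdRplus ≠ ⊤ := fun h =>
  T.t_inv_notMem_BdRplus (by rw [h]; exact Algebra.mem_top)

/-- (5.2.6.2) `B⁺_cris ⊂ B_cris`. DERIVED from `Bcris_eq_adjoin`. [folklore] -/
theorem Bcrisplus_le_Bcris : T.Bcrisplus ≤ T.Bcris := fun x hx => by
  rw [T.Bcris_eq_adjoin]; exact Algebra.subset_adjoin (Set.mem_union_left _ hx)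

/-- (5.2.6.2) `t⁻¹ ∈ B_cris`. DERIVED. [folklore] -/
theorem t_inv_mem_Bcris : (T.toBdR T.t)⁻¹ ∈ T.Bcris := by
  rw [T.Bcris_eq_adjoin]; exact Algebra.subset_adjoin (Set.mem_union_right _ rfl)

/-- (5.2.6.2) `B⁺ ↪ B_cris`. DERIVED. [folklore] -/
theorem toBdR_mem_Bcris_of_mem_Bplus {x : B} (hx : x ∈ D.Bplus) : T.toBdR x ∈ T.Bcris :=
  T.Bcrisplus_le_Bcris (T.image_Bplus_subset_Bcrisplus ⟨x, hx, rfl⟩)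

/-- `φ(tⁿ b) = pⁿ tⁿ φ(b)` in `B`. DERIVED from `frob_t`. [folklore] -/
theorem frobB_t_pow_mul (n : ℕ) (b : B) : T.frobB (T.t ^ n * b) = (p : B) ^ n * T.t ^ n * T.frobB b := by
  rw [map_mul, map_pow, T.frobB_apply T.t, T.frob_t, mul_pow]

/-- §5.2 p.38 l.41–44 «the ring `B[1/t]` is also quite natural»: `B[1/t] ⊂ B_dR`, the `ℚ_p`-subalgebra generated by `B` and
`t⁻¹`. [claim: Joshi2024ATS3, status: disputed] -/
def Bt : Subalgebra ℚ_[p] Ω := Algebra.adjoin ℚ_[p] ((T.toBdR.range : Set Ω) ∪ {(T.toBdR T.t)⁻¹})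

/-- Rmk. 5.2.2.1 p.39 l.25–28 «`B` has uncountably many maximal ideals … my construction of `Θ̃_Joshi` and `Θ̃_Mochizuki`
require using the fact that `B` has infinitely many maximal ideals» — READING predicate on E-t3's carrier `B` (to be taken
by name as a hypothesis where §6/§9 use it). [claim: Joshi2024ATS3, status: disputed] -/
@[claim "Joshi2024ATS3" "disputed"]
def BHasInfinitelyManyMaximalIdeals (R : Type) [CommRing R] : Prop := {I : Ideal R | I.IsMaximal}.Infinite

/-- The `G`-action on `B_dR = Ω` through `galΩ`, as a `MulAction` DEFINITION (not an instance; bind with `letI` to use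
`Joshi/Enlargements.lean` on subsets of `B_E ⊂ Ω` or of `Ω^{ℓ*}`). [folklore] -/
abbrev mulActionΩ : MulAction G Ω := MulAction.compHom Ω T.galΩ

/-- Unfolding `mulActionΩ`: `g • x = galΩ g x`. [folklore] -/
theorem mulActionΩ_smul (g : G) (x : Ω) : (letI := T.mulActionΩ; g • x) = T.galΩ g x := rfl

/-! ### §5.2.6 `B_e = B[1/t]^{φ=1}` -/

/-- (5.2.6.1) p.40 l.20–21, middle description «`B_e = B[1/t]^{φ=1}`», spelled with `φ` on `B` only (`φ(t) = p t`, so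
`φ(b/tⁿ) = φ(b)/(pⁿtⁿ)`): `x ∈ B_e` iff `tⁿ x = b ∈ B` with `φ(b) = pⁿ b` for some `n`. [claim: Joshi2024ATS3, status: disputed] -/
def Be : Set Ω := {x | ∃ (n : ℕ) (b : B), T.toBdR b = T.toBdR T.t ^ n * x ∧ D.frob b = (p : B) ^ n * b}

/-- Membership in `B_e`, unfolded. [folklore] -/
theorem mem_Be_iff (x : Ω) :
    x ∈ T.Be ↔ ∃ (n : ℕ) (b : B), T.toBdR b = T.toBdR T.t ^ n * x ∧ D.frob b = (p : B) ^ n * b := Iff.rfl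

/-- **`B_e` is a `ℚ_p`-subalgebra of `B_dR`** («the ring `B_e`», §5.2.6) — PROVED from the signature (`frobB` a ring
automorphism with `φ(t) = p t`). [folklore] -/
def BeSubalgebra : Subalgebra ℚ_[p] Ω where
  carrier := T.Be
  mul_mem' := by
    rintro x y ⟨n, b, hb, hφb⟩ ⟨m, c, hc, hφc⟩
    refine ⟨n + m, b * c, ?_, ?_⟩
    · rw [map_mul, hb, hc]; ring
    · have h := T.frobB_apply (b * c)
      rw [map_mul, T.frobB_apply, T.frobB_apply, hφb, hφc] at h
      rw [← h]; ring
  add_mem' := by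
    rintro x y ⟨n, b, hb, hφb⟩ ⟨m, c, hc, hφc⟩
    refine ⟨n + m, T.t ^ m * b + T.t ^ n * c, ?_, ?_⟩
    · rw [map_add, map_mul, map_mul, map_pow, map_pow, hb, hc]; ring
    · have h := T.frobB_apply (T.t ^ m * b + T.t ^ n * c)
      rw [map_add, T.frobB_t_pow_mul, T.frobB_t_pow_mul, T.frobB_apply, T.frobB_apply, hφb, hφc] at h
      rw [← h]; ring
  algebraMap_mem' := fun r => ⟨0, algebraMap ℚ_[p] B r, by rw [AlgHom.commutes, pow_zero, one_mul],
    by rw [← T.frobB_apply, AlgEquiv.commutes, pow_zero, one_mul]⟩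

/-- The carrier of `BeSubalgebra` is `Be`. [folklore] -/
theorem coe_BeSubalgebra : (T.BeSubalgebra : Set Ω) = T.Be := rfl

/-- `B_e ⊂ B[1/t]`. DERIVED. [folklore] -/
theorem Be_subset_Bt : T.Be ⊆ T.Bt := by
  rintro x ⟨n, b, hb, -⟩
  have ht : T.toBdR T.t ^ n ≠ 0 := pow_ne_zero n T.toBdR_t_ne_zero
  have hx : x = T.toBdR b * ((T.toBdR T.t)⁻¹) ^ n := by
    rw [hb, inv_pow, mul_comm (T.toBdR T.t ^ n) x, mul_assoc, mul_inv_cancel₀ ht, mul_one]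
  have h1 : T.toBdR b ∈ T.Bt :=
    Algebra.subset_adjoin (Set.mem_union_left _ ((AlgHom.mem_range T.toBdR).2 ⟨b, rfl⟩))
  have h2 : (T.toBdR T.t)⁻¹ ∈ T.Bt :=
    Algebra.subset_adjoin (Set.mem_union_right _ (Set.mem_singleton _))
  rw [hx]
  exact T.Bt.mul_mem h1 (T.Bt.pow_mem h2 n)

/-- (5.2.6.1), first description «`B_e = B⁺[1/t]^{φ=1}`» [FF18, Thm. 6.5.2]: the same set with `b ∈ B⁺`. CLAIM (equality
with `Be` is a cited fact, not derived). [claim: Joshi2024ATS3, status: disputed] -/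
@[claim "Joshi2024ATS3" "disputed"]
def BeEqBplusLoc : Prop :=
  T.Be = {x | ∃ (n : ℕ) (b : B), b ∈ D.Bplus ∧ T.toBdR b = T.toBdR T.t ^ n * x ∧ D.frob b = (p : B) ^ n * b}

/-- (5.2.6.1), third description «`B_e = B_cris^{φ=1}`» [FF18, Thm. 6.5.2]. CLAIM. [claim: Joshi2024ATS3, status: disputed] -/
@[claim "Joshi2024ATS3" "disputed"]
def BeEqBcrisPhiOne : Prop := T.Be = {x | ∃ h : x ∈ T.Bcris, (T.frobCris ⟨x, h⟩ : Ω) = x}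

/-! ### §5.2.3–§5.2.5 a `p`-adic field `E ⊃ E_0`, `B_E = B ⊗_{E_0} E ⊂ B_dR`, `B̃_E = B ⊗_{ℚ_p} E` -/

/-- (5.2.4.1) p.39 l.47 «`B_E = B ⊗_{E_0} E ↪ B_dR`»: `B_E ⊂ B_dR` is DEFINED as the `ℚ_p`-subalgebra generated by (the image
of) `B` and `E` — for any intermediate field `E` of `Ω/ℚ_p`. [claim: Joshi2024ATS3, status: disputed] -/
def BE (E : IntermediateField ℚ_[p] Ω) : Subalgebra ℚ_[p] Ω := T.toBdR.range ⊔ E.toSubalgebra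

/-- `B ⊂ B_E`. [folklore] -/
theorem toBdR_mem_BE (E : IntermediateField ℚ_[p] Ω) (b : B) : T.toBdR b ∈ T.BE E :=
  (le_sup_left : T.toBdR.range ≤ T.BE E) ⟨b, rfl⟩

/-- `E ⊂ B_E`. [folklore] -/
theorem mem_BE_of_mem (E : IntermediateField ℚ_[p] Ω) {e : Ω} (he : e ∈ E) : e ∈ T.BE E :=
  (le_sup_right : E.toSubalgebra ≤ T.BE E) he

/-- `B_E` is monotone in `E`. [folklore] -/
theorem BE_mono {E E' : IntermediateField ℚ_[p] Ω} (h : E ≤ E') : T.BE E ≤ T.BE E' :=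
  sup_le_sup_left (fun _ hx => h hx) _

/-- **SIGNATURE `BEDatum T`** — [J-III] §5.2.3 p.39 l.29–34 «Let `E` be a p-adic field and let `E_0 ⊂ E` be its maximal
unramified subfield», inside `Ω = B_dR ⊃ Q̄_p`: `E` finite over `ℚ_p`, the subfield `E_0 ≤ E` (DATA: its defining property
«maximal unramified» is not typed — only the consequence Joshi uses, §5.2.1 «`B` and `B⁺` are `E_0`-algebras», i.e.
`E_0 ⊂ B⁺` in `B_dR`), and the Frobenius `φ` OF `B_E` (§5.3.2 p.41 l.32 «`φ` is the Frobenius morphism of `B_E`») as a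
`ℚ_p`-algebra automorphism of `B_E` fixing `E` (its relation to `φ` on `B` — in [FF18] `φ_E = φ^{[E_0:ℚ_p]} ⊗ id` under
Lemma 5.2.3.1 — is NOT imposed here). [claim: Joshi2024ATS3, status: disputed] -/
structure BEDatum where
  /-- the `p`-adic field `E ⊂ Q̄_p ⊂ B_dR` -/
  E : IntermediateField ℚ_[p] Ω
  /-- `[E : ℚ_p] < ∞` -/
  finiteDimensional : FiniteDimensional ℚ_[p] E
  /-- its maximal unramified subfield `E_0` (data) -/
  E0 : IntermediateField ℚ_[p] Ω
  /-- `E_0 ⊂ E` -/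
  E0_le : E0 ≤ E
  /-- §5.2.1 p.39 l.9–12 «`B` and `B⁺` are `E_0`-algebras»: `E_0 = W(k_E)[1/p] ⊂ W(F̄_p)[1/p] ⊂ B⁺` inside `B_dR` -/
  E0_subset_Bplus : (E0 : Set Ω) ⊆ T.toBdR '' D.Bplus
  /-- the Frobenius `φ` of `B_E` (§5.3.2) -/
  frobBE : T.BE E ≃ₐ[ℚ_[p]] T.BE E
  /-- `φ` is `E`-linear: it fixes `E ⊂ B_E` -/
  frobBE_of_mem : ∀ (e : Ω) (he : e ∈ E), (frobBE ⟨e, T.mem_BE_of_mem E he⟩ : Ω) = e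

namespace BEDatum

variable {T} (ℰ : T.BEDatum)

/-- `f = [E_0 : ℚ_p]` (the number of factors in (5.2.5.3)–(5.2.5.4)). [claim: Joshi2024ATS3, status: disputed] -/
def f : ℕ := Module.finrank ℚ_[p] ℰ.E0

/-- `E_0 ⊂ B` (§5.2.1). DERIVED. [folklore] -/
theorem E0_le_range : ℰ.E0.toSubalgebra ≤ T.toBdR.range := fun x hx => by
  obtain ⟨b, -, hb⟩ := ℰ.E0_subset_Bplus hx
  exact ⟨b, hb⟩

/-- Hence `B_{E_0} = B` inside `B_dR` («`B ⊗_{ℚ_p} E_0`» collapses onto `B`, cf. (5.2.5.3)). DERIVED. [folklore] -/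
theorem BE_E0_eq_range : T.BE ℰ.E0 = T.toBdR.range := sup_eq_left.2 ℰ.E0_le_range

/-- The stabiliser `G_E = {g ∈ G | g|_E = id}` of `E` in the `G`-action on `B_dR` (the group acting in §5.3.1 when `G =
G_{ℚ_p}`). DERIVED (a subgroup). [folklore] -/
def GE : Subgroup G where
  carrier := {g | ∀ e ∈ ℰ.E, T.galΩ g e = e}
  one_mem' := fun e _ => by rw [map_one]; rfl
  mul_mem' := fun {g h} hg hh e he => by rw [map_mul, AlgEquiv.mul_apply, hh e he, hg e he]
  inv_mem' := fun {g} hg e he => by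
    rw [map_inv]
    exact (T.galΩ g).injective (by rw [← AlgEquiv.mul_apply, mul_inv_cancel, AlgEquiv.one_apply, hg e he])

/-- `G_E` stabilises `B_E` (as `G` stabilises `B`, by `galΩ_toBdR`, and `G_E` fixes `E`). DERIVED. [folklore] -/
theorem galΩ_mem_BE {g : G} (hg : g ∈ ℰ.GE) {x : Ω} (hx : x ∈ T.BE ℰ.E) : T.galΩ g x ∈ T.BE ℰ.E := by
  have hmap : (T.BE ℰ.E).map (T.galΩ g : Ω →ₐ[ℚ_[p]] Ω) ≤ T.BE ℰ.E := by
    rw [BE, (Subalgebra.gc_map_comap _).l_sup, sup_le_iff]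
    constructor
    · rintro _ ⟨_, ⟨b, rfl⟩, rfl⟩
      change T.galΩ g (T.toBdR b) ∈ T.BE ℰ.E
      rw [T.galΩ_toBdR]
      exact T.toBdR_mem_BE ℰ.E _
    · rintro _ ⟨e, he, rfl⟩
      change T.galΩ g e ∈ T.BE ℰ.E
      rw [hg e he]
      exact T.mem_BE_of_mem ℰ.E he
  exact hmap ⟨x, hx, rfl⟩

/-- Lemma 5.2.3.1 p.39 l.35–40 («`B_E ≃ B ⊗_{E_0} E` (5.2.3.2). Proof. This is [FF18, Prop. 1.6.9]») together with
(5.2.4.1) «`B ⊗_{E_0} E ↪ B_dR`», in instance-free form: **`B` and `E` are linearly disjoint over `E_0` in `B_dR`** —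
an `E_0`-linearly independent family in `E` stays `B`-linearly independent. CLAIM (cited fact; not derived).
[claim: Joshi2024ATS3, status: disputed] -/
@[claim "Joshi2024ATS3" "disputed"]
def BELinDisjoint : Prop :=
  ∀ (n : ℕ) (e : Fin n → Ω), (∀ i, e i ∈ ℰ.E) → LinearIndependent ℰ.E0 e →
    ∀ c : Fin n → B, ∑ i, T.toBdR (c i) * e i = 0 → ∀ i, c i = 0

/-- (5.2.5.1) p.39 l.52 «`B̃ = B ⊗_{ℚ_p} E`» — Mathlib's tensor product of `ℚ_p`-algebras. [claim: Joshi2024ATS3, status: disputed] -/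
abbrev Btilde : Type := B ⊗[ℚ_[p]] ℰ.E

/-- The multiplication map `B̃_E = B ⊗_{ℚ_p} E → B_dR`, `b ⊗ e ↦ b·e` (through which (5.2.5.4)/(5.2.5.5) compare `B̃_E`
with `B_E`). [folklore] -/
def btildeToBdR : ℰ.Btilde →ₐ[ℚ_[p]] Ω := Algebra.TensorProduct.productMap T.toBdR ℰ.E.val

/-- **The image of `B ⊗_{ℚ_p} E → B_dR` is exactly `B_E`** (so `B̃_E ↠ B_E`, the map implicit in (5.2.5.2)–(5.2.5.4)).
PROVED (Mathlib `productMap_range`). [folklore] -/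
theorem btildeToBdR_range : ℰ.btildeToBdR.range = T.BE ℰ.E := by
  unfold btildeToBdR BE
  rw [Algebra.TensorProduct.productMap_range, IntermediateField.range_val]

/-- (5.2.5.3) p.40 l.1–5 «since `B` is also an `E_0` algebra, `B ⊗_{ℚ_p} E_0 = B ⊕ ··· ⊕ B` (`[E_0:ℚ_p]` factors)».
CLAIM (as printed: an identification of rings; standard for `E_0/ℚ_p` Galois with `E_0 ⊂ B`, not derived here).
[claim: Joshi2024ATS3, status: disputed] -/
@[claim "Joshi2024ATS3" "disputed"]
def BtildeE0Splits : Prop := Nonempty ((B ⊗[ℚ_[p]] ℰ.E0) ≃ₐ[ℚ_[p]] (Fin ℰ.f → B))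

/-- (5.2.5.4) p.40 l.6–13 «`B̃_E = B_E ⊕ ··· ⊕ B_E` (`[E_0:ℚ_p]` factors) … `B̃_E = B ⊗_{ℚ_p} E` is naturally a finite and
free `B`-module». CLAIM. ((5.2.5.5), the diagonal `B_E ↪ B̃_E`, is then `e⁻¹ ∘ (x ↦ (x,…,x))` for any witness `e`: no
separate claim.) [claim: Joshi2024ATS3, status: disputed] -/
@[claim "Joshi2024ATS3" "disputed"]
def BtildeSplits : Prop := Nonempty (ℰ.Btilde ≃ₐ[ℚ_[p]] (Fin ℰ.f → T.BE ℰ.E))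

end BEDatum

end PeriodRingTower

end Summit.ABC.IUTFork.Joshi.ATS3

end
-- (comment-only enqueue re-land 2026-08-26: p429989's olean was never built on the farm — «stranded accept»; declarations byte-identical)
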